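import Summits.QuantumFields.BalabanUV.Beta.MultiscaleRegularityClosed
import Summits.QuantumFields.BalabanUV.Beta.MultiscaleGlobalMember

/-!
# Beta / MultiscaleSupRowSums — THE (2.16)-CURRENCY FORM OF THE SUP MEMBER: EXPONENTIALLY WEIGHTED ROW SUMS OF `(levelOp)⁻¹` IN THE
# SCALE-ADAPTED DISTANCE WITH THE LEVEL-FREE LOCAL PREFACTOR `n(x)²` — `Σ_q |(levelOp)⁻¹(δ_q)(p)|·e^{κ′d_n(p₁,q₁)} ≤ 𝔅·e^{2dδ}·N₀Λ∕(1 − Λe^{−(δ−κ′)})·n(p₁)²`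
# from the CLOSED sup member (file 17) by DUALITY per source cell and the cell growth sums (MODEL; closes the `n^{d₀+2}` gap of this
# lineage's gen-8 `MultiscaleDecayRowSums.wrs_inv_levelOp_le`, E-an4-136∕139; a brick of the level-free (w4-d)∕(w4-f) programme)

WHAT IS CERTIFIED (kernel, 0 sorry).  In the MODEL setting of `MultiscaleDecay.hc_levelOp` with a CONSTANT bond weight `c ≡ c₀ ≠ 0`, ANY
column-orthonormal `Rm`, `T`, graded sides with the sitewise additive datum, the (P) budget, `(1+d/2)log L/R ≤ κ`, `δ = κ − (1+d/2)log L/R`: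
* `apply_eq_sum_single` — the kernel representation `(Gu)(p) = Σ_q u(q)·G(δ_q)(p)` of a linear map on `X → ℝ`;
* **`cell_rowSum_le`** — DUALITY: for every cell `k′` and `p = (x,i)`, `Σ_{q : q₁ ∈ cell k′} |(levelOp)⁻¹(δ_q)(p)| ≤ 𝔅·n(x)²·e^{−δ·d_n(x,t_{k′})}`
  (file 17 `real_sup_levelOp_inverse_le` applied to the sign pattern of the row, a source supported in cell `k′` with `|u| ≤ 1`);
* **`wrs_levelOp_inverse_le_of_growth`** — for `0 ≤ κ′ ≤ δ`, an abstract growth clause `#{k′ : d_n(t_k,t_{k′}) < m} ≤ N₀Λ^m` and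
  `Λe^{−(δ−κ′)} < 1`: **`Σ_q |(levelOp)⁻¹(δ_q)(p)|·e^{κ′·d_n(x,q₁)} ≤ 𝔅·e^{2dδ}·N₀Λ∕(1 − Λe^{−(δ−κ′)})·n(x)²`** (corner thresholds
  `d_n(x,q₁) ≤ d_n(x,t_{k′}) + 2d`, `d_n(x,t_{k′}) ≥ d_n(t_{k_x},t_{k′}) − 2d`, this lineage's `sum_exp_neg_le_of_growth`);
* **`wrs_levelOp_inverse_le_of_grading`** — the growth clause DISCHARGED by road P3's `MultiscaleGrowthCells.cell_growth_add` (free `ε > 0`).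
So `(levelOp)⁻¹` IS a (2.16)-currency kernel with the scale-conjugated, LEVEL-FREE norm `wrs_{κ′,d_n}(n^{−2}·(levelOp)⁻¹) ≤ const(d, c₀, c_max,
a_max, C, κ, κ′, L, A, R, |Cp|, ε)` — print's `(L^jη)²`, where gen 8 had `n^{d₀+2}`.
(unit `b2b-balaban-beta-d4-p2`, GEN 11, MODEL crew; journal l.23681; consumer: the WRS-currency parametrix (w4-d)∕(w4-f).)

HONEST FRAMING: discharging `BetaPertH` makes Bałaban's UV stability UNCONDITIONAL — NOT the continuum limit, NOT the Clay problem.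
HONEST DEPENDENCY (verbatim): «continuum YM on T⁴ ⇐ BetaPertH ∧ nine spine estimates (0/9 proved); BetaPertH ⇐ (D1) ∧ (D4) ∧ CAP+tail;
G-an2-4 gates asym, D1 and NE2/3/4.»  THIS MODULE DISCHARGES NOTHING of `BetaPertH`, asserts NOTHING printed and cites nothing as a fact
(ABSOLUTE RULE): [folklore] finite-dimensional bookkeeping about the MODEL operator; nothing of Bałaban's G′(U).  LOCATORS (shape only):
[Balaban1988RG2Cluster] (2.16) p. 15; [Balaban1985BackgroundPropagators] (3.41)–(3.42) p. 397, (3.47) p. 398.  No class change on row D4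
(critical-path width 0; D4 DISCHARGE NO DATE); NOT BetaPertH, NOT continuum, NOT Clay, NOT summit progress.
-/

open scoped BigOperators
open Finset

namespace Summit.QuantumFields.BalabanUV.Beta.MultiscaleSupRowSums

open Summit.QuantumFields.BalabanUV.Beta.BoxPoincare (Box)
open Summit.QuantumFields.BalabanUV.Beta.MultiscaleCoerciveTorus
open Summit.QuantumFields.BalabanUV.Beta.MultiscaleDistance
open Summit.QuantumFields.BalabanUV.Beta.MultiscaleDistanceMetric (sdist_comm sdist_triangle_torus)
open Summit.QuantumFields.BalabanUV.Beta.MultiscaleDecayBudget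
open Summit.QuantumFields.BalabanUV.Beta.MultiscaleDecayRowSums (sum_exp_neg_le_of_growth)
open Summit.QuantumFields.BalabanUV.Beta.MultiscaleGrowthCells (cell_growth_add)
open Summit.QuantumFields.BalabanUV.Beta.MultiscaleCombesThomasL2CellsGraded (siteScale_ctrU)
open Summit.QuantumFields.BalabanUV.Beta.AccretiveCombesThomasSandwichSite (sdist_corner_thresholds)
open Summit.QuantumFields.BalabanUV.Beta.MultiscaleRegularityClosed (real_sup_levelOp_inverse_le)
open Summit.QuantumFields.BalabanUV.Beta.SubsolutionMeanValueBox (Cmv)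
open Literature.MathematicalPhysics.QuantumFieldTheory.Balaban1983to89
open Literature.MathematicalPhysics.QuantumFieldTheory.Balaban1983to89.B9Thm37GluePU (bsrc btgt)
open Literature.MathematicalPhysics.QuantumFieldTheory.Balaban1983to89.B9Thm37GlueTorusCov (tblk)
open Literature.MathematicalPhysics.QuantumFieldTheory.Balaban1983to89.B9Thm37GlueTorusCovLevels (levelOp)
open B5TorusCover (UT Ctr ctrU)

noncomputable section

/-! ## §1 The kernel representation of a linear map -/

/-- **`(Gu)(p) = Σ_q u(q)·G(δ_q)(p)`** for a linear endomorphism of `X → ℝ`, `X` finite. [folklore] -/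
theorem apply_eq_sum_single {X : Type} [Fintype X] [DecidableEq X] (G : Module.End ℝ (X → ℝ)) (u : X → ℝ) (p : X) :
    G u p = ∑ q, u q * G (Pi.single q 1) p := by
  have hu : u = ∑ q, u q • (Pi.single q (1 : ℝ) : X → ℝ) := by
    funext p'
    rw [Finset.sum_apply]
    simp only [Pi.smul_apply, Pi.single_apply, smul_eq_mul, mul_ite, mul_one, mul_zero]
    rw [Finset.sum_ite_eq]
    simp
  conv_lhs => rw [hu]
  rw [map_sum, Finset.sum_apply]
  refine Finset.sum_congr rfl fun q _ => ?_
  rw [map_smul, Pi.smul_apply, smul_eq_mul]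

variable {d : ℕ} {N : Fin d → ℕ} [∀ i, NeZero (N i)] [NeZero d] {Cp J K : Type} [Fintype Cp] [DecidableEq Cp] [Nonempty Cp]
  [Fintype J] [Fintype K] [DecidableEq K] (S : J → ℕ) (hS : ∀ l, 1 ≤ S l) (hdivS : ∀ l i, S l ∣ N i) (lvl : K → J)
  (zc : (k : K) → Ctr N (S (lvl k)))
  (hdisj : ∀ k k' v v', cellPt S hS hdivS lvl zc k v = cellPt S hS hdivS lvl zc k' v' → k = k')
  (hcover : ∀ x : UT N, ∃ k, ∃ v : Box d (S (lvl k)), cellPt S hS hdivS lvl zc k v = x)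
  (Rm : UT N × Fin d → Cp → Cp → ℝ) (hRm : ∀ b i j, ∑ k, Rm b k i * Rm b k j = if i = j then (1 : ℝ) else 0)
  (T : J → UT N → Cp → Cp → ℝ) (hT : ∀ l x i i', ∑ k, T l x k i * T l x k i' = if i = i' then (1 : ℝ) else 0)
  (a : J → ℝ) (ha : ∀ j, 0 ≤ a j) (ω : J → UT N → ℝ)
  (hsupp : ∀ l x, ω l (ctrU N (S l) (tblk (hS l) (hdivS l) x)) ≠ 0 → ∃ k v, lvl k = l ∧ cellPt S hS hdivS lvl zc k v = x)
  {amax : ℝ} (hamax : 0 ≤ amax)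
  (hscale : ∀ k, a (lvl k) * ω (lvl k) (ctrU N (S (lvl k)) (zc k)) ^ 2 * (S (lvl k) : ℝ) ^ d ≤ amax / (S (lvl k) : ℝ) ^ 2)
  (c : UT N × Fin d → ℝ) {c₀ : ℝ} (hcc : ∀ b, c b = c₀) (hc₀ : c₀ ≠ 0)
  {L : ℕ} (hL : 1 ≤ L) (e : J → ℕ) (hSe : ∀ l, S l = L ^ e l) {R : ℝ} (hR : 0 < R) {A : ℕ}
  (hadd : ∀ x y : UT N, |(e (lvl (cellOf S hS hdivS lvl zc hcover x)) : ℝ) - e (lvl (cellOf S hS hdivS lvl zc hcover y))| ≤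
    A + sdist bsrc btgt (siteScale S hS hdivS lvl zc hcover) x y / R)
  {cmax : ℝ} (hc : ∀ b, |c b| ≤ cmax) {C : ℝ}
  (hcoer : ∀ f : UT N × Cp → ℝ,
    C * ∑ k, ((S (lvl k) : ℝ) ^ 2)⁻¹ * ∑ v : Box d (S (lvl k)), ∑ i, f (cellPt S hS hdivS lvl zc k v, i) ^ 2 ≤
      ∑ p, f p * levelOp bsrc btgt c Rm (fun l x => ctrU N (S l) (tblk (hS l) (hdivS l) x))
        (fun l x => ω l (ctrU N (S l) (tblk (hS l) (hdivS l) x))) T a f p)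
  {κ : ℝ} (hκ0 : 0 ≤ κ) (hκ1 : κ ≤ 1) (hμ : 0 < C - 2 * d * cmax ^ 2 * κ ^ 2 - amax * (Real.exp (2 * d * κ) - 1))
  (hrate : (1 + d / 2) * (Real.log L / R) ≤ κ)
  {Γ θ δ 𝔅 : ℝ} (hΓ : Γ = (L : ℝ) ^ A * Real.exp (Real.log L / R * (4 * d + 1))) (hθ : θ = 1 / (4 * d * Γ))
  (hδ : δ = κ - (1 + d / 2) * (Real.log L / R))
  (h𝔅 : 𝔅 = (max (Real.sqrt (11 ^ d)) (Cmv d * Real.sqrt (21 ^ d)) / Real.sqrt (θ ^ d) +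
          Real.sqrt (Fintype.card Cp) * (θ + 1) ^ 2 * (amax * Γ ^ 2 * Real.sqrt (Γ ^ d)) / (2 * c₀ ^ 2)) *
        (Real.sqrt (Fintype.card Cp) * Real.exp (κ * ((4 * d + 1) + 2 * d)) *
          ((L : ℝ) ^ A * Real.exp (Real.log L / R * (4 * d + 1))) * (L : ℝ) ^ A * Real.sqrt (((L : ℝ) ^ A) ^ d) /
          (C - 2 * d * cmax ^ 2 * κ ^ 2 - amax * (Real.exp (2 * d * κ) - 1))) +
        Real.sqrt (Fintype.card Cp) * (θ + 1) ^ 2 / (2 * c₀ ^ 2) *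
          Real.exp ((κ - (1 + d / 2) * (Real.log L / R)) * ((4 * d + 1) + 2 * d)))

include hdisj hT ha hsupp hamax hscale hL e hSe hR hadd hRm hcc hc₀ hc hcoer hκ0 hκ1 hμ hrate hΓ hθ hδ h𝔅

/-! ## §2 Duality: the row sum over one source cell -/

/-- **THE ROW SUM OF `(levelOp)⁻¹` OVER ONE SOURCE CELL** (file 17's sup member at the sign pattern of the row): for every cell `k′` and
`p = (x,i)`, `Σ_{q : q₁ ∈ cell k′} |(levelOp)⁻¹(δ_q)(p)| ≤ 𝔅·n(x)²·e^{−δ·d_n(x,t_{k′})}`. [folklore] -/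
theorem cell_rowSum_le (k' : K) (p : UT N × Cp) :
    ∑ q ∈ univ.filter (fun q : UT N × Cp => cellOf S hS hdivS lvl zc hcover q.1 = k'),
        |(Ring.inverse (levelOp bsrc btgt c Rm (fun l x => ctrU N (S l) (tblk (hS l) (hdivS l) x))
          (fun l x => ω l (ctrU N (S l) (tblk (hS l) (hdivS l) x))) T a)) (Pi.single q 1) p| ≤
      𝔅 * (siteScale S hS hdivS lvl zc hcover p.1 : ℝ) ^ 2 *
        Real.exp (-(δ * sdist bsrc btgt (siteScale S hS hdivS lvl zc hcover) p.1 (ctrU N (S (lvl k')) (zc k')))) := by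
  classical
  set G := Ring.inverse (levelOp bsrc btgt c Rm (fun l x => ctrU N (S l) (tblk (hS l) (hdivS l) x))
    (fun l x => ω l (ctrU N (S l) (tblk (hS l) (hdivS l) x))) T a) with hG
  -- the sign pattern of the row, restricted to the cell
  set σ : UT N × Cp → ℝ := fun q => if cellOf S hS hdivS lvl zc hcover q.1 = k' then
    (if 0 ≤ G (Pi.single q 1) p then 1 else -1) else 0 with hσ
  have hσsupp : ∀ q, cellOf S hS hdivS lvl zc hcover q.1 ≠ k' → σ q = 0 := fun q hq => by simp only [hσ, if_neg hq]
  have hσabs : ∀ q, |σ q| ≤ 1 := by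
    intro q
    simp only [hσ]
    split_ifs <;> simp
  have h17 := real_sup_levelOp_inverse_le S hS hdivS lvl zc hdisj hcover Rm hRm T hT a ha ω hsupp hamax hscale c hcc hc₀ hL e hSe hR
    hadd hc hcoer hκ0 hκ1 hμ hrate hΓ hθ k' σ hσsupp zero_le_one hσabs p
  rw [← h𝔅, ← hδ, mul_one, ← hG] at h17
  -- duality: `(Gσ)(p) = Σ_{cell k′} |G(δ_q)(p)|`
  have hdual : G σ p = ∑ q ∈ univ.filter (fun q : UT N × Cp => cellOf S hS hdivS lvl zc hcover q.1 = k'), |G (Pi.single q 1) p| := by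
    rw [apply_eq_sum_single G σ p, Finset.sum_filter]
    refine Finset.sum_congr rfl fun q _ => ?_
    by_cases hq : cellOf S hS hdivS lvl zc hcover q.1 = k'
    · simp only [hσ, hq, if_true]
      by_cases hs : 0 ≤ G (Pi.single q 1) p
      · rw [if_pos hs, one_mul, abs_of_nonneg hs]
      · rw [if_neg hs, abs_of_neg (lt_of_not_ge hs)]; ring
    · simp only [hσ, hq, if_false, zero_mul]
  rw [← hdual]
  exact (le_abs_self _).trans h17

/-! ## §3 The weighted row sum from an abstract growth clause -/

/-- **THE (2.16)-CURRENCY SUP MEMBER FOR `levelOp` — EXPONENTIALLY WEIGHTED ROW SUMS IN `d_n` WITH THE LOCAL PREFACTOR `n(x)²`, LEVEL-FREE,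
from an abstract growth clause** `#{k′ : d_n(t_k,t_{k′}) < m} ≤ N₀Λ^m` on the cell family: for `0 ≤ κ′ ≤ δ` with `Λe^{−(δ−κ′)} < 1` and
every `p = (x,i)`: `Σ_q |(levelOp)⁻¹(δ_q)(p)|·e^{κ′·d_n(x,q₁)} ≤ 𝔅·e^{2dδ}·(N₀Λ/(1 − Λe^{−(δ−κ′)}))·n(x)²`.  Per source cell: §2, the corner
thresholds `d_n(x,q₁) ≤ d_n(x,t_{k′}) + 2d` (source) and `d_n(x,t_{k′}) ≥ d_n(t_{k_x},t_{k′}) − 2d` (target), then the growth sum.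
[cite: Balaban1988RG2Cluster, (2.16) p.15; Balaban1985BackgroundPropagators, (3.41)-(3.42) p.397] [folklore] -/
theorem wrs_levelOp_inverse_le_of_growth {N₀ Λ : ℝ} (hN₀ : 0 ≤ N₀) (hΛ : 0 ≤ Λ)
    (hcount : ∀ (k : K) (m : ℕ), ((univ.filter fun k' => sdist bsrc btgt (siteScale S hS hdivS lvl zc hcover)
        (ctrU N (S (lvl k)) (zc k)) (ctrU N (S (lvl k')) (zc k')) < m).card : ℝ) ≤ N₀ * Λ ^ m)
    {κ' : ℝ} (hκ'0 : 0 ≤ κ') (hκ'δ : κ' ≤ δ) (hq : Λ * Real.exp (-(δ - κ')) < 1) (p : UT N × Cp) :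
    ∑ q, |(Ring.inverse (levelOp bsrc btgt c Rm (fun l x => ctrU N (S l) (tblk (hS l) (hdivS l) x))
          (fun l x => ω l (ctrU N (S l) (tblk (hS l) (hdivS l) x))) T a)) (Pi.single q 1) p| *
        Real.exp (κ' * sdist bsrc btgt (siteScale S hS hdivS lvl zc hcover) p.1 q.1) ≤
      𝔅 * Real.exp (2 * d * δ) * (N₀ * Λ / (1 - Λ * Real.exp (-(δ - κ')))) * (siteScale S hS hdivS lvl zc hcover p.1 : ℝ) ^ 2 := by
  classical
  set G := Ring.inverse (levelOp bsrc btgt c Rm (fun l x => ctrU N (S l) (tblk (hS l) (hdivS l) x))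
    (fun l x => ω l (ctrU N (S l) (tblk (hS l) (hdivS l) x))) T a) with hG
  set n := siteScale S hS hdivS lvl zc hcover with hn
  set x := p.1 with hx
  set D : K → ℝ := fun k' => sdist bsrc btgt n x (ctrU N (S (lvl k')) (zc k')) with hD
  set Dc : K → ℝ := fun k' => sdist bsrc btgt n (ctrU N (S (lvl (cellOf S hS hdivS lvl zc hcover x))) (zc (cellOf S hS hdivS lvl zc hcover x)))
    (ctrU N (S (lvl k')) (zc k')) with hDc
  -- `𝔅 ≥ 0` (it bounds a nonnegative quantity at any cell: use §2 with the nonneg left side)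
  obtain ⟨k₀, -⟩ := hcover x
  have h𝔅0 : 0 ≤ 𝔅 := by
    have h := cell_rowSum_le S hS hdivS lvl zc hdisj hcover Rm hRm T hT a ha ω hsupp hamax hscale c hcc hc₀ hL e hSe hR hadd hc hcoer
      hκ0 hκ1 hμ hrate hΓ hθ hδ h𝔅 k₀ p
    have h0 : 0 ≤ ∑ q ∈ univ.filter (fun q : UT N × Cp => cellOf S hS hdivS lvl zc hcover q.1 = k₀), |G (Pi.single q 1) p| :=
      Finset.sum_nonneg fun _ _ => abs_nonneg _
    have hpos : 0 < (n x : ℝ) ^ 2 * Real.exp (-(δ * sdist bsrc btgt n x (ctrU N (S (lvl k₀)) (zc k₀)))) := by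
      have : (0 : ℝ) < (n x : ℝ) := by exact_mod_cast one_le_siteScale S hS hdivS lvl zc hcover x
      positivity
    have h1 : 0 ≤ 𝔅 * ((n x : ℝ) ^ 2 * Real.exp (-(δ * sdist bsrc btgt n x (ctrU N (S (lvl k₀)) (zc k₀))))) := by
      rw [← mul_assoc]; exact h0.trans (by simpa only [hG, hn, hx] using h)
    exact nonneg_of_mul_nonneg_left h1 hpos
  -- per source cell, with the weight
  have hδκ : 0 ≤ δ - κ' := by linarith
  have hcell : ∀ k', ∑ q ∈ univ.filter (fun q : UT N × Cp => cellOf S hS hdivS lvl zc hcover q.1 = k'),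
      |G (Pi.single q 1) p| * Real.exp (κ' * sdist bsrc btgt n x q.1) ≤ 𝔅 * Real.exp (2 * d * δ) * (n x : ℝ) ^ 2 * Real.exp (-((δ - κ') * Dc k')) := by
    intro k'
    have h2 := cell_rowSum_le S hS hdivS lvl zc hdisj hcover Rm hRm T hT a ha ω hsupp hamax hscale c hcc hc₀ hL e hSe hR hadd hc hcoer
      hκ0 hκ1 hμ hrate hΓ hθ hδ h𝔅 k' p
    simp only [← hG, ← hn, ← hx] at h2
    -- the weight on the cell: `d_n(x,q₁) ≤ D k′ + 2d`
    have hw : ∀ q ∈ univ.filter (fun q : UT N × Cp => cellOf S hS hdivS lvl zc hcover q.1 = k'),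
        Real.exp (κ' * sdist bsrc btgt n x q.1) ≤ Real.exp (κ' * (D k' + 2 * d)) := by
      intro q hq
      have hqk := (Finset.mem_filter.mp hq).2
      have h2d : sdist bsrc btgt n q.1 (ctrU N (S (lvl k')) (zc k')) ≤ 2 * d :=
        (sdist_corner_thresholds S hS hdivS lvl zc hdisj hcover q.1 k').1 hqk
      have htri := sdist_triangle_torus n x (ctrU N (S (lvl k')) (zc k')) q.1
      rw [sdist_comm bsrc btgt n (ctrU N (S (lvl k')) (zc k')) q.1] at htri
      exact Real.exp_le_exp.mpr (mul_le_mul_of_nonneg_left (by simp only [hD]; linarith) hκ'0)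
    -- the target threshold: `D k′ ≥ Dc k′ − 2d`
    have hthr : Dc k' - 2 * d ≤ D k' := by
      have h := (sdist_corner_thresholds S hS hdivS lvl zc hdisj hcover x k').2
      simpa only [hD, hDc, hn] using h
    have hexp : Real.exp (κ' * (D k' + 2 * d)) * Real.exp (-(δ * D k')) ≤ Real.exp (2 * d * δ) * Real.exp (-((δ - κ') * Dc k')) := by
      rw [← Real.exp_add, ← Real.exp_add]
      refine Real.exp_le_exp.mpr ?_
      nlinarith [mul_le_mul_of_nonneg_left hthr hδκ]
    calc ∑ q ∈ univ.filter (fun q : UT N × Cp => cellOf S hS hdivS lvl zc hcover q.1 = k'),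
          |G (Pi.single q 1) p| * Real.exp (κ' * sdist bsrc btgt n x q.1)
        ≤ ∑ q ∈ univ.filter (fun q : UT N × Cp => cellOf S hS hdivS lvl zc hcover q.1 = k'),
            |G (Pi.single q 1) p| * Real.exp (κ' * (D k' + 2 * d)) :=
          Finset.sum_le_sum fun q hq => mul_le_mul_of_nonneg_left (hw q hq) (abs_nonneg _)
      _ = (∑ q ∈ univ.filter (fun q : UT N × Cp => cellOf S hS hdivS lvl zc hcover q.1 = k'), |G (Pi.single q 1) p|) *
            Real.exp (κ' * (D k' + 2 * d)) := by rw [Finset.sum_mul]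
      _ ≤ 𝔅 * (n x : ℝ) ^ 2 * Real.exp (-(δ * D k')) * Real.exp (κ' * (D k' + 2 * d)) :=
          mul_le_mul_of_nonneg_right h2 (Real.exp_pos _).le
      _ = 𝔅 * (n x : ℝ) ^ 2 * (Real.exp (κ' * (D k' + 2 * d)) * Real.exp (-(δ * D k'))) := by ring
      _ ≤ 𝔅 * (n x : ℝ) ^ 2 * (Real.exp (2 * d * δ) * Real.exp (-((δ - κ') * Dc k'))) :=
          mul_le_mul_of_nonneg_left hexp (by positivity)
      _ = _ := by ring
  -- fibrewise over the source cells
  have hfib : ∑ q, |G (Pi.single q 1) p| * Real.exp (κ' * sdist bsrc btgt n x q.1) =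
      ∑ k', ∑ q ∈ univ.filter (fun q : UT N × Cp => cellOf S hS hdivS lvl zc hcover q.1 = k'),
        |G (Pi.single q 1) p| * Real.exp (κ' * sdist bsrc btgt n x q.1) := by
    rw [← Finset.sum_fiberwise (s := (univ : Finset (UT N × Cp))) (g := fun q => cellOf S hS hdivS lvl zc hcover q.1)]
  -- the growth sum
  have hsum : ∑ k', Real.exp (-((δ - κ') * Dc k')) ≤ N₀ * Λ / (1 - Λ * Real.exp (-(δ - κ'))) :=
    sum_exp_neg_le_of_growth Dc (fun k' => sdist_nonneg bsrc btgt n _ _) hN₀ hΛ (hcount (cellOf S hS hdivS lvl zc hcover x)) hδκ hq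
  have hK : 0 ≤ 𝔅 * Real.exp (2 * d * δ) * (n x : ℝ) ^ 2 := by positivity
  have hgoal : ∑ q, |G (Pi.single q 1) p| * Real.exp (κ' * sdist bsrc btgt n x q.1) ≤
      𝔅 * Real.exp (2 * d * δ) * (N₀ * Λ / (1 - Λ * Real.exp (-(δ - κ')))) * (n x : ℝ) ^ 2 := by
    rw [hfib]
    calc ∑ k', ∑ q ∈ univ.filter (fun q : UT N × Cp => cellOf S hS hdivS lvl zc hcover q.1 = k'),
          |G (Pi.single q 1) p| * Real.exp (κ' * sdist bsrc btgt n x q.1)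
        ≤ ∑ k', 𝔅 * Real.exp (2 * d * δ) * (n x : ℝ) ^ 2 * Real.exp (-((δ - κ') * Dc k')) := Finset.sum_le_sum fun k' _ => hcell k'
      _ = 𝔅 * Real.exp (2 * d * δ) * (n x : ℝ) ^ 2 * ∑ k', Real.exp (-((δ - κ') * Dc k')) := by rw [Finset.mul_sum]
      _ ≤ 𝔅 * Real.exp (2 * d * δ) * (n x : ℝ) ^ 2 * (N₀ * Λ / (1 - Λ * Real.exp (-(δ - κ')))) := mul_le_mul_of_nonneg_left hsum hK
      _ = _ := by ring
  simpa only [hG, hn, hx] using hgoal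

/-! ## §4 The growth clause DISCHARGED by the grading -/

/-- **THE (2.16)-CURRENCY SUP MEMBER FOR `levelOp`, growth clause discharged** by road P3's `MultiscaleGrowthCells.cell_growth_add` from the
SAME sitewise additive datum (free `ε > 0`; `N₀ = (3(L^A)²)^d·(d!/ε^d)·e^{2d(ε + (log L/R)d)}`, `Λ = e^{ε + 2(log L/R)d}`): for `0 ≤ κ′ ≤ δ` with
`Λe^{−(δ−κ′)} < 1`, `Σ_q |(levelOp)⁻¹(δ_q)(p)|·e^{κ′d_n(x,q₁)} ≤ 𝔅·e^{2dδ}·N₀Λ/(1 − Λe^{−(δ−κ′)})·n(x)²` — NO binder, NO named fact.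
[cite: Balaban1988RG2Cluster, (2.16) p.15; Balaban1985BackgroundPropagators, (3.41)-(3.42) p.397] [folklore] -/
theorem wrs_levelOp_inverse_le_of_grading {ε : ℝ} (hε : 0 < ε) {κ' : ℝ} (hκ'0 : 0 ≤ κ') (hκ'δ : κ' ≤ δ)
    (hq : Real.exp (ε + 2 * (Real.log L / R) * d) * Real.exp (-(δ - κ')) < 1) (p : UT N × Cp) :
    ∑ q, |(Ring.inverse (levelOp bsrc btgt c Rm (fun l x => ctrU N (S l) (tblk (hS l) (hdivS l) x))
          (fun l x => ω l (ctrU N (S l) (tblk (hS l) (hdivS l) x))) T a)) (Pi.single q 1) p| *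
        Real.exp (κ' * sdist bsrc btgt (siteScale S hS hdivS lvl zc hcover) p.1 q.1) ≤
      𝔅 * Real.exp (2 * d * δ) *
        ((3 * ((L : ℝ) ^ A) ^ 2) ^ d * ((d.factorial : ℝ) / ε ^ d) * Real.exp (2 * d * (ε + Real.log L / R * d)) *
            Real.exp (ε + 2 * (Real.log L / R) * d) /
          (1 - Real.exp (ε + 2 * (Real.log L / R) * d) * Real.exp (-(δ - κ')))) *
        (siteScale S hS hdivS lvl zc hcover p.1 : ℝ) ^ 2 := by
  have hgr : ∀ y, siteScale S hS hdivS lvl zc hcover y = L ^ (e (lvl (cellOf S hS hdivS lvl zc hcover y))) := fun y => by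
    rw [siteScale, hSe]
  have hcount := fun (k : K) (m : ℕ) =>
    cell_growth_add S hS hdivS lvl zc hdisj hcover hL (fun y => e (lvl (cellOf S hS hdivS lvl zc hcover y))) hgr hR (A := A)
      hadd hε k m
  exact wrs_levelOp_inverse_le_of_growth S hS hdivS lvl zc hdisj hcover Rm hRm T hT a ha ω hsupp hamax hscale c hcc hc₀ hL e hSe hR
    hadd hc hcoer hκ0 hκ1 hμ hrate hΓ hθ hδ h𝔅 (by positivity) (Real.exp_pos _).le hcount hκ'0 hκ'δ hq p

end

end Summit.QuantumFields.BalabanUV.Beta.MultiscaleSupRowSums
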